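import Summits.CriticalPhenomena.PercolationContinuityZ3.Theorems.PercNearOneGluingNoHeavyLowerTailSahiCombJunta
import Summits.CriticalPhenomena.PercolationContinuityZ3.Theorems.PercNearOneGluingNoHeavyLowerTailSahiC3CombCubeFour

/-!
# `NoHeavyLowerTail` (crux stmt-CriticalPhenomena-4575), the junta-intersection theorem with FOUR coordinates — COMPUTATIONAL companion of
# `…SahiCombJunta` (uses the `native_decide` certificate `SahiC3Cube.checkCube_four` through `…SahiC3CombCubeFour`)

Support file (cell `prim-l12`, seat P3, gen 2; `--supports stmt-CriticalPhenomena-4575`; proposed `--computational`: every theorem here has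
`SahiC3Cube.checkCube_four` in its axiom closure; nothing else non-standard, no `sorry`).

* `cubeCombPos3_of_card_le_four` — (M⁺-3) on every cube `↥W` with `|W| ≤ 4` (`SahiC3CombCube.combPos_sahiE_three_of_card_le_four`);
* **`combPos_sahiE_three_of_inter_determinedBy_card_le_four`** — if `A ∩ B` is determined by at most FOUR coordinates then
  `p ↦ E₃(μ_p; 1_U,1_A,1_B)` is comb-positive for every increasing `U`, in every dimension (`…SahiCombJunta.combPos_sahiE_three_of_inter_determinedBy`);
* the law-level corollary (Kahn's Conjecture 5 / Sahi's `C₃` for product measures on this class) and the three-partition corollary (every twist).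
-/

noncomputable section

open scoped Classical

namespace Summit.CriticalPhenomena.PercolationContinuityZ3.Theorems

namespace SahiCombJunta

open Finset Function
open Literature.Combinatorics.Sahi2008
open Literature.Probability.Percolation (DeterminedBy)
open Literature.Probability.Percolation.DecisionTree (ind)
open SahiComb

variable {ι : Type} [Fintype ι]

/-- (M⁺-3) on the cube `↥W` for `|W| ≤ 4` (kernel certificate, `native_decide`). [this work] -/
theorem cubeCombPos3_of_card_le_four (W : Set ι) (hW : Fintype.card ↥W ≤ 4) : CubeCombPos3 W :=
  fun _ _ _ hX hY hZ => SahiC3CombCube.combPos_sahiE_three_of_card_le_four hW hX hY hZ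

/-- **Junta-intersection with four coordinates**: if `A ∩ B` is determined by a set `W` of at most four coordinates, then (M⁺-3) holds for
`(U, A, B)` for every increasing `U`, in every dimension. [this work] -/
theorem combPos_sahiE_three_of_inter_determinedBy_card_le_four (W : Finset ι) (hW : W.card ≤ 4) {U A B : Set (Set ι)}
    (hU : IsUpperSet U) (hA : IsUpperSet A) (hB : IsUpperSet B) (hK : DeterminedBy (A ∩ B) (↑W : Set ι)) :
    CombPos (fun _ : ι => 3) (fun p => sahiE (bernoulliWeight p) 3 ![ind U, ind A, ind B]) :=
  combPos_sahiE_three_of_inter_determinedBy W (cubeCombPos3_of_card_le_four _ (by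
    rw [← Set.toFinset_card, Finset.toFinset_coe]
    exact hW)) hU hA hB hK

/-- Law level: `E₃(μ_p; U, A, B) ≥ 0` whenever `A ∩ B` depends on at most four coordinates (every product measure, every dimension).
[this work] -/
theorem sahiE_three_ind_nonneg_of_inter_determinedBy_card_le_four (p : ι → unitInterval) (W : Finset ι) (hW : W.card ≤ 4)
    {U A B : Set (Set ι)} (hU : IsUpperSet U) (hA : IsUpperSet A) (hB : IsUpperSet B) (hK : DeterminedBy (A ∩ B) (↑W : Set ι)) :
    0 ≤ sahiE (bernoulliWeight p) 3 ![ind U, ind A, ind B] :=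
  (combPos_sahiE_three_of_inter_determinedBy_card_le_four W hW hU hA hB hK).nonneg p

/-- (★★) on the four-coordinate junta class: `threePartNT τ U A B ≥ 0` for every twist. [this work] -/
theorem threePartNT_nonneg_of_inter_determinedBy_card_le_four (τ : Set ι) (W : Finset ι) (hW : W.card ≤ 4) {U A B : Set (Set ι)}
    (hU : IsUpperSet U) (hA : IsUpperSet A) (hB : IsUpperSet B) (hK : DeterminedBy (A ∩ B) (↑W : Set ι)) :
    0 ≤ ThreePartition.threePartNT τ U A B :=
  ThreePartition.threePartNT_nonneg_of_combPos τ (combPos_sahiE_three_of_inter_determinedBy_card_le_four W hW hU hA hB hK)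

end SahiCombJunta

end Summit.CriticalPhenomena.PercolationContinuityZ3.Theorems
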